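import Summits.HodgeConjecture.CorCM.Census.CentralSquaresDihedralOrderFour
import Summits.HodgeConjecture.CorCM.Census.CentralSquaresDihedralRows

/-!
# The square-central class, XXXIII: EVERY dihedral quotient with kernel of order two — `μ(G, c) = φ₂(G, c) = β(G, c) − 2`

COR-CM (cell `pub-hodgecm2`), count-neutral kernel combinatorics by the binder seat b09 (gen 46; lane SQUARE-CENTRAL CLASS, part XXXIII), assembling part XXII
(`isLeast_card_gfaces_generate_of_dihedral_quotient_two`: an involution over `s`), part XXXII (`…_of_dihedral_quotient_four`: no involution over `s` nor over
`sr`) and part XI (`fibreTwo_add_two_eq_card_block_of_dihedral_quotient'`) BY NAME; the case of an involution over `sr` only is reduced to part XXII by the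
outer automorphism `r ↦ r`, `srⁱ ↦ srⁱ⁺³` of `D₄` (a term inside the proof, checked by `decide`).  Theorems only: no definition, no certificate, no named
fact, no `sorry`.  HONEST FRAMING: `HC_CM` is NOT proved, here or anywhere in the tree; nothing here is a period or a headline.

* **`isLeast_card_gfaces_generate_of_dihedral_kernel_two`**: `G` finite, `c` a central involution, `π : G ↠ D₄` with `π c = r²` and `|ker π| = 2` ⟹
  `μ(G, c) = φ₂(G, c)` — NO hypothesis on reflection lifts.  `…_block`: `= β(G, c) − 2`.
  The three rows of order 16 with a `D₄` quotient by a central subgroup of order `2` — `D₄ × ℤ/2`, `G(16,3)` (all three central involutions), `ℤ/4 ⋊ ℤ/4`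
  (`c = a²` and `c = a²y²`) — are instances by name (design note `CENTRAL-SQUARES-M2.md` §4–6).

## References
* [Pohlmann1968] H. Pohlmann, Algebraic cycles on abelian varieties of complex multiplication type, Ann. of Math. 88 (1968), Thm 1.
* [Milne1999] J. S. Milne, Lefschetz motives and the Tate conjecture, Compositio Math. 117 (1999), Prop. 2.1, p. 54.
-/

namespace Summit.HodgeConjecture.CorCM.Census.CentralSquares

open Finset DihedralGroup
open Summit.HodgeConjecture.CorCM.Prior.AllgGroup.RfwfAllgGroup
open Summit.HodgeConjecture.CorCM.Census.BlockParity
open Summit.HodgeConjecture.CorCM.Census.Coinvariant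
open Summit.HodgeConjecture.CorCM.Census.TwistGeneration
open Summit.HodgeConjecture.CorCM.Census.BaseBlock
open Summit.HodgeConjecture.CorCM.Census.CoverClosure

noncomputable section

variable {G : Type*} [Group G] [Fintype G] [DecidableEq G]

/-- **EVERY DIHEDRAL QUOTIENT WITH KERNEL OF ORDER TWO.**  `G` a finite group, `c` a central involution, `π : G →* D₄` surjective with `π c = r²` and
`|ker π| = 2`: **`μ(G, c) = φ₂(G, c)`**. [folklore] -/
theorem isLeast_card_gfaces_generate_of_dihedral_kernel_two {c : G} (hc2 : c * c = 1) (hcen : ∀ x : G, x * c = c * x)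
    (π : G →* DihedralGroup 4) (hπ : Function.Surjective π) (hπc : π c = r 2) (hker : Nat.card π.ker = 2) :
    IsLeast {n : ℕ | ∃ S : Finset (CMF G c →₀ ℤ), (↑S ⊆ gfaceSet G c hc2) ∧ S.card = n ∧
      hodgeSpan c hc2 ≤ Submodule.span ℤ (pairSet c) ⊔ Submodule.span ℤ (translates c S)} (fibreTwo c hc2) := by
  classical
  obtain ⟨q, hq⟩ := hπ (sr 0)
  obtain ⟨g₁, hg₁⟩ := hπ (sr 1)
  by_cases hqq : q * q = 1
  · exact isLeast_card_gfaces_generate_of_dihedral_quotient_two hc2 hcen π hπ hπc hker q hq hqq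
  by_cases hgg : g₁ * g₁ = 1
  · -- twist `π` by the outer automorphism `r ↦ r`, `srⁱ ↦ srⁱ⁺³`, which carries `sr` to `s` and fixes `r²`
    let ψ : DihedralGroup 4 →* DihedralGroup 4 :=
      { toFun := fun x => match x with
          | r i => r i
          | sr i => sr (i + 3)
        map_one' := by decide
        map_mul' := by decide }
    have hψ1 : ∀ a : DihedralGroup 4, ψ a = 1 ↔ a = 1 := by decide
    have hψsurj : Function.Surjective ψ := by
      intro y
      obtain ⟨x, hx⟩ : ∃ x : DihedralGroup 4, ψ x = y := by revert y; decide
      exact ⟨x, hx⟩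
    have hπ' : Function.Surjective (ψ.comp π) := hψsurj.comp hπ
    have hπc' : (ψ.comp π) c = r 2 := by rw [MonoidHom.comp_apply, hπc]; decide
    have hker' : Nat.card (ψ.comp π).ker = 2 := by
      have e : (ψ.comp π).ker = π.ker := by
        ext x; rw [MonoidHom.mem_ker, MonoidHom.mem_ker, MonoidHom.comp_apply, hψ1]
      rw [e]; exact hker
    have hg₁' : (ψ.comp π) g₁ = sr 0 := by rw [MonoidHom.comp_apply, hg₁]; decide
    exact isLeast_card_gfaces_generate_of_dihedral_quotient_two hc2 hcen (ψ.comp π) hπ' hπc' hker' g₁ hg₁' hgg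
  exact isLeast_card_gfaces_generate_of_dihedral_quotient_four hc2 hcen π hπ hπc hker q hq hqq g₁ hg₁ hgg

/-- **`μ = β − 2` for every dihedral quotient with kernel of order two.** [folklore] -/
theorem isLeast_card_gfaces_generate_of_dihedral_kernel_two_block {c : G} (hc2 : c * c = 1) (hcen : ∀ x : G, x * c = c * x)
    (π : G →* DihedralGroup 4) (hπ : Function.Surjective π) (hπc : π c = r 2) (hker : Nat.card π.ker = 2) :
    IsLeast {n : ℕ | ∃ S : Finset (CMF G c →₀ ℤ), (↑S ⊆ gfaceSet G c hc2) ∧ S.card = n ∧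
      hodgeSpan c hc2 ≤ Submodule.span ℤ (pairSet c) ⊔ Submodule.span ℤ (translates c S)} (Fintype.card (Block c) - 2) := by
  classical
  have hG : IsPGroup 2 G := by
    refine IsPGroup.of_card (n := 4) ?_
    have h := card_filter_comap π hπ (univ : Finset (DihedralGroup 4))
    rw [filter_true_of_mem (fun g _ => mem_univ (π g)), card_univ, card_univ, hker] at h
    rw [Nat.card_eq_fintype_card, h]; rfl
  have h := fibreTwo_add_two_eq_card_block_of_dihedral_quotient' hG hc2 hcen π hπ hπc
  rw [show Fintype.card (Block c) - 2 = fibreTwo c hc2 by omega]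
  exact isLeast_card_gfaces_generate_of_dihedral_kernel_two hc2 hcen π hπ hπc hker

end

end Summit.HodgeConjecture.CorCM.Census.CentralSquares
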